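import Literature.Barriers.SmoothPoincare4.CappellShanesonFamilyStandardProofs
import HarnessLib

/-!
# The column Δ-move is equivalent to the row Δ-move

Sibling proof file of `Literature/Barriers/SmoothPoincare4/CappellShanesonFamilyStandardProofs.lean`
on the **column Δ-move** of R. Gompf, *More Cappell–Shaneson spheres are standard*, Algebr.
Geom. Topol. 10 (2010) 1665–1681, Thm. 2.1 with §3 ¶3: for `A ∈ SL(3, ℤ)` in standard form with
`det (A - 1) = 1`, the move `A ↦ A Δᵏ` ("the conjugate operation on the second column") does not
change the Cappell–Shaneson spheres — framing-free: every Cappell–Shaneson sphere `X : Type u` of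
`A` is diffeomorphic to one, in `Type`, of `A * gompfDelta ^ k`. In the parent file this is the
THEOREM `gompf2010_deltaMoveRight_of_deltaMove` (the column move from the row move
`Literature.Topology.FourManifolds.gompf2010_deltaMove`: `A Δᵏ = A (Δᵏ A) A⁻¹` and surgered
mapping tori of linear monodromies are invariant under based conjugation,
`IsSurgeredMappingTorusOf.torusDiffeomorph_mul_comm`).

History (D-0026/D-0027). The column move was at first also minted as a separate named fact of
the parent file (provefact triage XL). This file proved it **equivalent** to the row move — the
converse `gompf2010_deltaMove_of_deltaMoveRight` (the same conjugation read backwards) and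
`gompf2010_deltaMoveRight_iff_deltaMove` — and recorded its **one-leaf form**
`gompf2010_deltaMoveRight_of_framedTwist` from the framed Theorem 2.1 **F** =
`Literature.Topology.FourManifolds.gompf2010_framedTwist` (`GompfTheorem43.lean`), read off the
*right* clause of **F** (§4 ¶3: "`B` is obtained from `A` by left- or right-multiplying it by a
power `Δᵏ` … in fact `X^{τ·σ}_B = X^σ_A`") and the proved classification of Cappell–Shaneson
spheres by straightenings (`gompf2010_straightening_classification_holds`). Being equivalent to
an existing leaf, the separate named fact was not an independent proof obligation; on review
(2026-08-15) it was MERGED back into the parent's theorem, and the theorems of this file are now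
stated on the column-move statement written out (as the conclusion of
`gompf2010_deltaMoveRight_of_deltaMove` is). No definitions, no named facts; the single
geometric obligation behind row and column moves is **F** (Gompf's Theorem 2.1 proper on `T³`:
the fishtail neighbourhood and Lemma 2.2, the multiplicity-one logarithmic transformation), and
`gompf2010_deltaMove_holds` will be `gompf2010_deltaMove_of_framedTwist'` of
`CappellShanesonDeltaMoveProofs.lean` applied to `gompf2010_framedTwist_holds`.

## References

* [GompfAGT2010] R. E. Gompf, *More Cappell–Shaneson spheres are standard*, Algebr. Geom. Topol.
  10 (2010) 1665–1681, doi:10.2140/agt.2010.10.1665 (arXiv:0908.1914): Thm. 2.1; §3 ¶1 (the pair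
  of spheres "only depends on the conjugacy class of `A`"), §3 ¶3 ("This allows us to change `A`
  (in standard form) by adding any multiple of the second row to the third while subtracting the
  same multiple from the first, or by the conjugate operation on the second column, without
  changing the resulting pair of diffeomorphism types"); §4 ¶3 (left or right multiplication by
  `Δᵏ`, `X^{τ·σ}_B = X^σ_A`).
-/

noncomputable section

open Set Literature.Topology.FourManifolds
open scoped Manifold ContDiff MatrixGroups

namespace Literature.Barriers.SmoothPoincare4

universe u

/-- **The row move follows from the column move** (converse of
`gompf2010_deltaMoveRight_of_deltaMove`; Gompf 2010, §3 ¶1: the pair of spheres "only depends on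
the conjugacy class of `A`", ¶3: the column move is "the conjugate operation" of the row move). A
Cappell–Shaneson sphere `X` of `A` is diffeomorphic, by the column move (the hypothesis, written
out: every Cappell–Shaneson sphere `X : Type u` of a standard-form `A` with `det (A - 1) = 1` is
diffeomorphic to one, in `Type`, of `A Δᵏ`), to a sphere `X'` of `A Δᵏ`; since
`Δᵏ A = A⁻¹ (A Δᵏ) A`, the surgered mapping torus `X'` of the linear monodromy `A Δᵏ` is one of
`Δᵏ A` — same manifold, same mapping torus, fibre coordinates changed by the based diffeomorphism
`torusDiffeomorph A` (`IsSurgeredMappingTorusOf.torusDiffeomorph_mul_comm`) — and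
`det (Δᵏ A - 1) = det (A - 1) = 1` (`IsGompfStandardForm.det_gompfDelta_zpow_mul_sub_one`). [cite: GompfAGT2010, Thm 2.1 and §3 ¶1, ¶3 (conjugacy invariance; the conjugate operation on the second column)] -/
theorem gompf2010_deltaMove_of_deltaMoveRight
    (hR : ∀ (A : SL(3, ℤ)) (_ : IsGompfStandardForm A) (_ : (A.1 - 1).det = 1) (k : ℤ)
      (X : Type u) [TopologicalSpace X] [T2Space X] [SecondCountableTopology X]
      [ChartedSpace (EuclideanSpace ℝ (Fin 4)) X] [IsManifold (𝓡 4) ∞ X] [CompactSpace X],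
      IsCappellShanesonSphereOf A X →
        ∃ (X' : Type) (_ : TopologicalSpace X') (_ : T2Space X') (_ : SecondCountableTopology X')
          (_ : ChartedSpace (EuclideanSpace ℝ (Fin 4)) X') (_ : IsManifold (𝓡 4) ∞ X')
          (_ : CompactSpace X'),
          IsCappellShanesonSphereOf (A * gompfDelta ^ k) X' ∧ Nonempty (X ≃ₘ⟮𝓡 4, 𝓡 4⟯ X')) :
    gompf2010_deltaMove.{u} := by
  intro A hA hdet k X _ _ _ _ _ _ hX
  obtain ⟨X', _, _, _, _, _, _, h', e⟩ := hR A hA hdet k X hX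
  refine ⟨X', ‹_›, ‹_›, ‹_›, ‹_›, ‹_›, ‹_›, ?_, e⟩
  exact h'.isSurgeredMappingTorusOf.torusDiffeomorph_mul_comm.isCappellShanesonSphereOf
    (Or.inl (by rw [hA.det_gompfDelta_zpow_mul_sub_one]; exact hdet))

/-- **Row and column Δ-moves are equivalent statements** (Gompf 2010, §3 ¶3: Theorem 2.1 changes
`A` in standard form "by adding any multiple of the second row to the third while subtracting the
same multiple from the first, or by the conjugate operation on the second column, without
changing the resulting pair of diffeomorphism types"): at every universe, the column-move
statement (written out) `↔ gompf2010_deltaMove` — `gompf2010_deltaMove_of_deltaMoveRight` and the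
parent file's `gompf2010_deltaMoveRight_of_deltaMove`. This equivalence is why the column move is
not a separate named fact: the single remaining obligation behind both moves is Theorem 2.1
proper in its framed form `gompf2010_framedTwist` (`gompf2010_deltaMoveRight_of_framedTwist`). [cite: GompfAGT2010, Thm 2.1 and §3 ¶3 (row and column Δ-moves on matrices in standard form)] -/
theorem gompf2010_deltaMoveRight_iff_deltaMove :
    (∀ (A : SL(3, ℤ)) (_ : IsGompfStandardForm A) (_ : (A.1 - 1).det = 1) (k : ℤ)
      (X : Type u) [TopologicalSpace X] [T2Space X] [SecondCountableTopology X]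
      [ChartedSpace (EuclideanSpace ℝ (Fin 4)) X] [IsManifold (𝓡 4) ∞ X] [CompactSpace X],
      IsCappellShanesonSphereOf A X →
        ∃ (X' : Type) (_ : TopologicalSpace X') (_ : T2Space X') (_ : SecondCountableTopology X')
          (_ : ChartedSpace (EuclideanSpace ℝ (Fin 4)) X') (_ : IsManifold (𝓡 4) ∞ X')
          (_ : CompactSpace X'),
          IsCappellShanesonSphereOf (A * gompfDelta ^ k) X' ∧ Nonempty (X ≃ₘ⟮𝓡 4, 𝓡 4⟯ X')) ↔
      gompf2010_deltaMove.{u} :=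
  ⟨gompf2010_deltaMove_of_deltaMoveRight, fun hΔ => gompf2010_deltaMoveRight_of_deltaMove hΔ⟩

/-- **The column move from the framed Theorem 2.1, right clause** (Gompf 2010, §4 ¶3: "`B` is
obtained from `A` by left- or right-multiplying it by a power `Δᵏ` … in fact `X^{τ·σ}_B = X^σ_A`
for each straightening `σ`"). Every Cappell–Shaneson sphere `X` of a standard-form `A` is
diffeomorphic to some concrete `X^σ_A = gompfSphere A γ` (the proved classification
`gompf2010_straightening_classification_holds`, `GompfSectionCircleFramings.lean`), which the
*right* clause of `gompf2010_framedTwist` identifies with `gompfSphere (A Δᵏ) (γ.deltaRight k)`,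
a Cappell–Shaneson sphere of `A Δᵏ` in `Type` (`isCappellShanesonSphereOf_gompfSphere`, as
`det (A Δᵏ - 1) = det (A - 1) = 1`, `det_mul_gompfDelta_zpow_sub_one`). (The row clause gives the
same through `gompf2010_deltaMove_of_framedTwist` and `gompf2010_deltaMoveRight_of_deltaMove`,
`gompf2010_deltaMoveRight_of_framedTwist'`.) [cite: GompfAGT2010, §4 ¶3 (X^{τ·σ}_B = X^σ_A for B = A Δᵏ) and Thm 2.1, §3 ¶3] -/
theorem gompf2010_deltaMoveRight_of_framedTwist (hF : gompf2010_framedTwist) :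
    ∀ (A : SL(3, ℤ)) (_ : IsGompfStandardForm A) (_ : (A.1 - 1).det = 1) (k : ℤ)
      (X : Type u) [TopologicalSpace X] [T2Space X] [SecondCountableTopology X]
      [ChartedSpace (EuclideanSpace ℝ (Fin 4)) X] [IsManifold (𝓡 4) ∞ X] [CompactSpace X],
      IsCappellShanesonSphereOf A X →
        ∃ (X' : Type) (_ : TopologicalSpace X') (_ : T2Space X') (_ : SecondCountableTopology X')
          (_ : ChartedSpace (EuclideanSpace ℝ (Fin 4)) X') (_ : IsManifold (𝓡 4) ∞ X')
          (_ : CompactSpace X'),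
          IsCappellShanesonSphereOf (A * gompfDelta ^ k) X' ∧ Nonempty (X ≃ₘ⟮𝓡 4, 𝓡 4⟯ X') := by
  intro A hA hdet k X _ _ _ _ _ _ hX
  obtain ⟨γ, h⟩ := gompf2010_straightening_classification_holds A X hX
  refine ⟨gompfSphere (A * gompfDelta ^ k) (γ.deltaRight k), inferInstance, inferInstance,
    inferInstance, inferInstance, inferInstance, inferInstance,
    isCappellShanesonSphereOf_gompfSphere _ _ (Or.inl ?_),
    nonempty_diffeomorph_trans h (hF A hA hdet γ k).2⟩
  rw [det_mul_gompfDelta_zpow_sub_one hA]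
  exact hdet

/-- The one-leaf form through the row clause agrees: `gompf2010_framedTwist` gives the row move
(`gompf2010_deltaMove_of_framedTwist` with the proved classification), hence the column move
(`gompf2010_deltaMoveRight_of_deltaMove`). [cite: GompfAGT2010, §4 ¶3 (X^{τ·σ}_B = X^σ_A for B = Δᵏ A) and §3 ¶3] -/
theorem gompf2010_deltaMoveRight_of_framedTwist' (hF : gompf2010_framedTwist) :
    ∀ (A : SL(3, ℤ)) (_ : IsGompfStandardForm A) (_ : (A.1 - 1).det = 1) (k : ℤ)
      (X : Type u) [TopologicalSpace X] [T2Space X] [SecondCountableTopology X]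
      [ChartedSpace (EuclideanSpace ℝ (Fin 4)) X] [IsManifold (𝓡 4) ∞ X] [CompactSpace X],
      IsCappellShanesonSphereOf A X →
        ∃ (X' : Type) (_ : TopologicalSpace X') (_ : T2Space X') (_ : SecondCountableTopology X')
          (_ : ChartedSpace (EuclideanSpace ℝ (Fin 4)) X') (_ : IsManifold (𝓡 4) ∞ X')
          (_ : CompactSpace X'),
          IsCappellShanesonSphereOf (A * gompfDelta ^ k) X' ∧ Nonempty (X ≃ₘ⟮𝓡 4, 𝓡 4⟯ X') :=
  fun A hA hdet k X _ _ _ _ _ _ hX =>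
    gompf2010_deltaMoveRight_of_deltaMove
      (gompf2010_deltaMove_of_framedTwist hF gompf2010_straightening_classification_holds)
      A hA hdet k X hX

end Literature.Barriers.SmoothPoincare4

end
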